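import Summits.ValiantsHypothesis.ValiantsHypothesis.Theorems.KPlusLogSqLawTropicalOrbitRules
import Summits.ValiantsHypothesis.ValiantsHypothesis.Theorems.LacunarySymmetroidMatrixDescartesCensusTropicalKLawStatic

/-!
# Tropical census, symmetric designs — CARRIER SHAPES in the transpose-orbit model: a transposition orbit that carries is cycle-constant

HONEST FRAMING.  Helper file (seat val-sym-lift-p2 (g6), cell `pub-symmetroid`, 2026-08-27; `--supports` the `WeakLifting` item
stmt-ValiantsHypothesis-19561 as a helper, no closure claim).  Pure lemma file in the orbit-carrier model of `…TropicalOrbitDominance`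
(theory g23 / typer g10–g11): item (b) of the port plan of the method memo `HOME/theory/g23/method/TSYM34-METHOD-g23.md` §4 («the
carrier-shape lemma: orbit-dominant ⇒ `D` / `T_p` cycle-constant / `C`; single-term: already `isDominant_symm_involutive`»), general `m`, `K`,
integer slopes.  Nothing here is a census numeral: tropical objects bound no real pencil; the orbit row targets `TSymOrb34Le17` / `TSymOrb34Le16`
stay targets (NOT asserted); ζ_sym(3,4) ∈ {18,19}, DoorA34 = `PosRootLawAt 3 4 18` (stmt-ValiantsHypothesis-19980) and DoorA26 (stmt-19979) are
untouched (OPEN, typed, never asserted); nothing on `TropicalB` / `WeakLifting` as closed, on `MatrixDescartes` (stmt-ValiantsHypothesis-18050) or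
on VP ≠ VNP.

CONTENT.
* `tropWeight_swap_midpoint`: for SYMMETRIC valuations, a transposition term `(swap i j, c)` is the MIDPOINT of the two terms obtained by
  making the pair letters equal: `W(swap i j, c[j ↦ c i]) + W(swap i j, c[i ↦ c j]) = 2·W(swap i j, c)` (any `m`, `K`, `θ`).
* `isOrbitDominant_swap_cycleConstant`: hence an ORBIT-dominant transposition term of a symmetric design is cycle-constant (`c i = c j`):
  otherwise the two cycle-constant terms are present, lie outside the orbit `{P, Pᵀ}`, and cannot both be strictly below their midpoint.
* `isOrbitDominant_symm_three_shape` (`m = 3`): an orbit-dominant term of a symmetric `3 × 3` design is an identity term `D(λ)`, a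
  cycle-constant transposition term `T_p(b|a)`, or a fixed-point-free (3-cycle, «pair carrier») term — the five carrier types of the cell's
  COMBO-BOUND model.
[folklore] (midpoint / two-point exchange argument; method memo §3 last paragraph)
-/

-- `Summit.ValiantsHypothesis.ValiantsHypothesis.…` is the tree's mandated single-conjunct layout (Sub = Summit).
set_option linter.dupNamespace false
set_option autoImplicit false

namespace Summit.ValiantsHypothesis.ValiantsHypothesis.Theorems.LacunarySymmetroidMatrixDescartes.TropicalCensus.Orbit

open Summit.ValiantsHypothesis.ValiantsHypothesis.Theorems.MatrixDescartes.Negative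
open Summit.ValiantsHypothesis.ValiantsHypothesis.Theorems.LacunarySymmetroidMatrixDescartes
open Summit.ValiantsHypothesis.ValiantsHypothesis.Theorems.LacunarySymmetroidMatrixDescartes.TropicalCensus
open Finset

variable {m K : ℕ}

/-- **Midpoint identity.**  For symmetric valuations, `W(swap i j, c[j ↦ c i]) + W(swap i j, c[i ↦ c j]) = 2·W(swap i j, c)`. [folklore] -/
theorem tropWeight_swap_midpoint (d : Fin K → ℕ) (v : Fin m → Fin m → Fin K → ℤ) (hv : ∀ i j l, v i j l = v j i l) (θ : ℤ)
    (i j : Fin m) (c : Fin m → Fin K) :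
    tropWeight d v θ (Equiv.swap i j, fun l => if l = j then c i else c l) +
        tropWeight d v θ (Equiv.swap i j, fun l => if l = i then c j else c l) =
      2 * tropWeight d v θ (Equiv.swap i j, c) := by
  unfold tropWeight
  dsimp only
  rw [sum_apply_replace (fun _ x => (d x : ℤ)) c j (c i), sum_apply_replace (fun _ x => (d x : ℤ)) c i (c j),
    sum_apply_replace (fun l x => v ((Equiv.swap i j) l) l x) c j (c i),
    sum_apply_replace (fun l x => v ((Equiv.swap i j) l) l x) c i (c j)]
  simp only [Equiv.swap_apply_left, Equiv.swap_apply_right]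
  rw [hv j i (c i), hv j i (c j)]
  ring

/-- a term all of whose cells carry present letters is present. [folklore] -/
theorem termSign_ne_zero_of_forall (ε : Fin m → Fin m → Fin K → ℤ) (σ : Equiv.Perm (Fin m)) (c : Fin m → Fin K)
    (h : ∀ l, ε (σ l) l (c l) ≠ 0) : termSign ε (σ, c) ≠ 0 := by
  unfold termSign
  exact mul_ne_zero (Units.ne_zero _) (prod_ne_zero_iff.mpr fun l _ => h l)

/-- **An orbit-dominant transposition term of a symmetric design is cycle-constant.**  If `(swap i j, c)` is orbit-dominant (present and
strictly above every present term outside its transpose orbit) for symmetric `v`, `ε`, then `c i = c j`. [folklore; method memo §3] -/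
theorem isOrbitDominant_swap_cycleConstant (d : Fin K → ℕ) (v ε : Fin m → Fin m → Fin K → ℤ)
    (hv : ∀ i j l, v i j l = v j i l) (hε : ∀ i j l, ε i j l = ε j i l) {θ : ℤ} {i j : Fin m} (hij : i ≠ j)
    (c : Fin m → Fin K) (h : IsOrbitDominant d v ε θ (Equiv.swap i j, c)) : c i = c j := by
  by_contra hne
  have hpres := present_of_termSign_ne_zero ε (Equiv.swap i j, c) h.1
  -- the two cycle-constant competitors are present
  have hA : termSign ε (Equiv.swap i j, fun l => if l = j then c i else c l) ≠ 0 := by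
    refine termSign_ne_zero_of_forall ε _ _ fun l => ?_
    by_cases hl : l = j
    · subst hl
      rw [if_pos rfl, Equiv.swap_apply_right, hε]
      have := hpres i
      rwa [Equiv.swap_apply_left] at this
    · rw [if_neg hl]; exact hpres l
  have hB : termSign ε (Equiv.swap i j, fun l => if l = i then c j else c l) ≠ 0 := by
    refine termSign_ne_zero_of_forall ε _ _ fun l => ?_
    by_cases hl : l = i
    · subst hl
      rw [if_pos rfl, Equiv.swap_apply_left, hε]
      have := hpres j
      rwa [Equiv.swap_apply_right] at this
    · rw [if_neg hl]; exact hpres l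
  -- they differ from the term and from its transpose
  have hT : transposeTerm (Equiv.swap i j, c) = (Equiv.swap i j, fun l => c ((Equiv.swap i j) l)) := by
    simp [transposeTerm, Equiv.swap_inv]
  have hA1 : ((Equiv.swap i j, fun l => if l = j then c i else c l) : Equiv.Perm (Fin m) × (Fin m → Fin K)) ≠ (Equiv.swap i j, c) := by
    intro hq
    have := congrFun (congrArg Prod.snd hq) j
    simp only [if_true] at this
    exact hne this
  have hA2 : ((Equiv.swap i j, fun l => if l = j then c i else c l) : Equiv.Perm (Fin m) × (Fin m → Fin K)) ≠
      transposeTerm (Equiv.swap i j, c) := by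
    rw [hT]
    intro hq
    have := congrFun (congrArg Prod.snd hq) i
    simp only [if_neg hij, Equiv.swap_apply_left] at this
    exact hne this
  have hB1 : ((Equiv.swap i j, fun l => if l = i then c j else c l) : Equiv.Perm (Fin m) × (Fin m → Fin K)) ≠ (Equiv.swap i j, c) := by
    intro hq
    have := congrFun (congrArg Prod.snd hq) i
    simp only [if_true] at this
    exact hne this.symm
  have hB2 : ((Equiv.swap i j, fun l => if l = i then c j else c l) : Equiv.Perm (Fin m) × (Fin m → Fin K)) ≠
      transposeTerm (Equiv.swap i j, c) := by
    rw [hT]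
    intro hq
    have := congrFun (congrArg Prod.snd hq) j
    simp only [if_neg hij.symm, Equiv.swap_apply_right] at this
    exact hne this.symm
  have c1 := h.2 _ hA1 hA2 hA
  have c2 := h.2 _ hB1 hB2 hB
  have hmid := tropWeight_swap_midpoint d v hv θ i j c
  linarith

/-- the permutations of `Fin 3`: identity, a transposition, or fixed-point-free. [folklore] -/
theorem perm_three_shape : ∀ σ : Equiv.Perm (Fin 3),
    σ = 1 ∨ (∃ i j : Fin 3, i < j ∧ σ = Equiv.swap i j) ∨ (∀ i, σ i ≠ i) := by decide

/-- **Carrier shapes of the orbit model at `m = 3`.**  An orbit-dominant term of a SYMMETRIC `3 × 3` design is an identity term `D(λ)`,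
a CYCLE-CONSTANT transposition term `(swap i j, c)` with `c i = c j` (type `T_p(b|a)`), or a fixed-point-free term (a 3-cycle: the PAIR
carrier `C(c)` of the cell's five-type model). [folklore; method memo §1/§3] -/
theorem isOrbitDominant_symm_three_shape (d : Fin K → ℕ) (v ε : Fin 3 → Fin 3 → Fin K → ℤ)
    (hv : ∀ i j l, v i j l = v j i l) (hε : ∀ i j l, ε i j l = ε j i l) {θ : ℤ}
    (σ : Equiv.Perm (Fin 3)) (c : Fin 3 → Fin K) (h : IsOrbitDominant d v ε θ (σ, c)) :
    σ = 1 ∨ (∃ i j : Fin 3, i < j ∧ σ = Equiv.swap i j ∧ c i = c j) ∨ (∀ i, σ i ≠ i) := by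
  rcases perm_three_shape σ with h1 | ⟨i, j, hij, hs⟩ | h3
  · exact Or.inl h1
  · subst hs
    exact Or.inr (Or.inl ⟨i, j, hij, rfl, isOrbitDominant_swap_cycleConstant d v ε hv hε (ne_of_lt hij) c h⟩)
  · exact Or.inr (Or.inr h3)

end Summit.ValiantsHypothesis.ValiantsHypothesis.Theorems.LacunarySymmetroidMatrixDescartes.TropicalCensus.Orbit
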